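import Mathlib
import HarnessLib
import Summits.AtomisticToContinuum.Crystallization.Theses.FlatToriSuffice

/-!
# Line `delete-close-pairs` — birth skeleton of `PricedClosePairs`
(X_C of the scale split of `TorusDefectGap`; item `stmt-AtomisticToContinuum-17670`, support,
route `FlatToriSuffice`)

`PricedClosePairs` (at every periodic LJ minimiser `P₀` there are `r, c > 0` with
`c · #D_r(P) ≤ #motif · (e(P) − e(P₀))` for every periodic `P`, `D_r(P)` = motif points with another
point of `P` within distance `< r`) ⟸ two stubs about the Lennard-Jones energy of periodic
configurations (NO minimiser involved) and a PROVED composition that spends the minimality of `P₀`: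

* `stub_thinSurgery` — DELETE ALL CLOSE-PAIR POINTS: for every price `c₀` there is `r₀ > 0` such that
  for `0 < r ≤ r₀` and every periodic `P` with at least one `r`-isolated motif point there is a periodic
  `P'` (namely `P` with `D_r` removed from the motif, same lattice) with `#P'.motif + #D_r = #motif` and
  `#motif · e(P) ≥ #P'.motif · e(P') + c₀ · #D_r`. Content: torus pair-sum bookkeeping
  `U(P) = U(P') + cross + U_D`; the surviving points are `r`-isolated, so `cross ≥ −#D · C₆(r)` (shell
  counting of an `r`-separated set, `V_LJ ≥ −ρ⁻⁶/6`); every point of `D`'s orbit has a neighbour within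
  `r` inside that orbit, so `V = θρ⁻¹²/12 + W_θ` with `W_θ = (1−θ)⁻¹ V_LJ(·/(1−θ)^{1/6})` (a rescaled LJ,
  stable on periodic configurations) gives `U_D ≥ #D (θ r⁻¹²/24 − B_θ)`; `r⁻¹²` beats `C₆(r) ~ r⁻³`.
* `stub_denseRepulsion` — EVERYONE CROWDED: for every `c₀` there is `r₀ > 0` such that for
  `0 < r ≤ r₀` a periodic `P` in which EVERY motif point has another point within `r` has
  `e(P) ≥ c₀` (the same `U_D` bound with `D` = everything).
* `PricedClosePairs_of` — PROVED composition: with `c₀ := 1 + e(P₀)` and `r := min r₀ r₀'`, in the thin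
  case `#motif e(P) ≥ #P' e(P') + c₀ #D ≥ #P' e(P₀) + c₀ #D = #motif e(P₀) + #D` by MINIMALITY of `P₀`
  (`e(P') ≥ e(P₀)`); in the dense case `#motif (e(P) − e(P₀)) ≥ #motif = #D`. So `c = 1`.
-/

noncomputable section

open scoped Classical

namespace Summit.AtomisticToContinuum.Crystallization.Cruxes.PricedClosePairs.DeleteClosePairs

open Literature.MathematicalPhysics.StatisticalMechanics
open Summit.AtomisticToContinuum.Crystallization.Theses.FlatToriSuffice (PricedClosePairs)

local notation "E3" => EuclideanSpace ℝ (Fin 3)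
local notation "PC" => Literature.MathematicalPhysics.StatisticalMechanics.PeriodicConfiguration 3

/-- STUB A statement — THIN SURGERY (delete all close-pair points at once). -/
def ThinSurgery : Prop :=
  ∀ c₀ : ℝ, ∃ r₀ : ℝ, 0 < r₀ ∧ ∀ r : ℝ, 0 < r → r ≤ r₀ → ∀ P : PC,
    (∃ x ∈ P.motif, ¬ ∃ z ∈ P.points, z ≠ x ∧ dist z x < r) →
    ∃ P' : PC,
      (P'.motif.card : ℝ) + ({x : E3 | x ∈ P.motif ∧ ∃ z ∈ P.points, z ≠ x ∧ dist z x < r}.ncard : ℝ)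
          = P.motif.card ∧
      (P'.motif.card : ℝ) * P'.energyPerParticle lennardJones
          + c₀ * ({x : E3 | x ∈ P.motif ∧ ∃ z ∈ P.points, z ≠ x ∧ dist z x < r}.ncard : ℝ)
        ≤ (P.motif.card : ℝ) * P.energyPerParticle lennardJones

/-- STUB B statement — DENSE REPULSION (every motif point crowded). -/
def DenseRepulsion : Prop :=
  ∀ c₀ : ℝ, ∃ r₀ : ℝ, 0 < r₀ ∧ ∀ r : ℝ, 0 < r → r ≤ r₀ → ∀ P : PC,
    (∀ x ∈ P.motif, ∃ z ∈ P.points, z ≠ x ∧ dist z x < r) →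
    c₀ ≤ P.energyPerParticle lennardJones

/-- **Stub A — thin surgery.** See the module docstring: `P'` = `P` with the close-pair motif points
`D_r` deleted (same lattice; non-empty by hypothesis); the inequality is torus pair-sum bookkeeping +
the packing bound for the `r`-isolated survivors (tree: `card_le_of_separated_of_dist_le`,
`summable_lennardJones_dist_three`) + stability of a rescaled Lennard-Jones potential for the
deleted orbit, in which every point has a neighbour within `r`. Size L. [Ruelle1969 §3.2;
BlancLewin2015 §1.3] -/
theorem stub_thinSurgery : ThinSurgery := by
  sorry

/-- **Stub B — dense repulsion.** A periodic configuration in which every point has another point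
within `r` has energy per particle `≥ θ r⁻¹²/24 − B_θ → +∞` as `r → 0` (nearest-neighbour
repulsion + stability of the rescaled LJ remainder `W_θ`). Size M. [Ruelle1969 §3.2] -/
theorem stub_denseRepulsion : DenseRepulsion := by
  sorry

namespace Registered
/-- registered stub signature -/
abbrev stub_thinSurgery : Prop := ThinSurgery
/-- registered stub signature -/
abbrev stub_denseRepulsion : Prop := DenseRepulsion
end Registered

/-- **Composition (proved)**: thin surgery + dense repulsion ⇒ `PricedClosePairs`, spending the
minimality of `P₀` on the sub-configuration `P'` (thin case) and the crude count `#D = #motif`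
(dense case); `c = 1`, `r = min r₀ r₀'` at price `c₀ = 1 + e(P₀)`. -/
theorem PricedClosePairs_of (hA : Registered.stub_thinSurgery)
    (hB : Registered.stub_denseRepulsion) : PricedClosePairs := by
  intro P₀ hmin
  obtain ⟨r₁, hr₁, hA'⟩ := hA (1 + P₀.energyPerParticle lennardJones)
  obtain ⟨r₂, hr₂, hB'⟩ := hB (1 + P₀.energyPerParticle lennardJones)
  have hr : 0 < min r₁ r₂ := lt_min hr₁ hr₂
  refine ⟨min r₁ r₂, 1, hr, one_pos, fun P => ?_⟩
  have hcard_nn : (0 : ℝ) ≤ P.motif.card := Nat.cast_nonneg _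
  by_cases hthin : ∃ x ∈ P.motif, ¬ ∃ z ∈ P.points, z ≠ x ∧ dist z x < min r₁ r₂
  · obtain ⟨P', hcard, hineq⟩ := hA' (min r₁ r₂) hr (min_le_left _ _) P hthin
    have hmin' : P₀.energyPerParticle lennardJones ≤ P'.energyPerParticle lennardJones :=
      hmin.2 ⟨P', rfl⟩
    have hP'nn : (0 : ℝ) ≤ P'.motif.card := Nat.cast_nonneg _
    have hprod := mul_le_mul_of_nonneg_left hmin' hP'nn
    have h1 : (P'.motif.card : ℝ) * P₀.energyPerParticle lennardJones
        + ({x : E3 | x ∈ P.motif ∧ ∃ z ∈ P.points, z ≠ x ∧ dist z x < min r₁ r₂}.ncard : ℝ)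
            * P₀.energyPerParticle lennardJones
        = (P.motif.card : ℝ) * P₀.energyPerParticle lennardJones := by
      rw [← add_mul, hcard]
    linarith [hprod, hineq, h1]
  · push Not at hthin
    have hdense := hB' (min r₁ r₂) hr (min_le_right _ _) P hthin
    have hDn : ({x : E3 | x ∈ P.motif ∧ ∃ z ∈ P.points, z ≠ x ∧ dist z x < min r₁ r₂}.ncard : ℝ)
        = P.motif.card := by
      have hset : {x : E3 | x ∈ P.motif ∧ ∃ z ∈ P.points, z ≠ x ∧ dist z x < min r₁ r₂}
          = (↑P.motif : Set E3) := by
        ext x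
        simp only [Set.mem_setOf_eq, Finset.mem_coe]
        exact ⟨fun h => h.1, fun h => ⟨h, hthin x h⟩⟩
      rw [hset, Set.ncard_coe_finset]
    rw [hDn]
    nlinarith [hdense, hcard_nn]

end Summit.AtomisticToContinuum.Crystallization.Cruxes.PricedClosePairs.DeleteClosePairs

end
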